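import Summits.CriticalPhenomena.PercolationContinuityZ3.Theorems.PercNearOneGluingNoHeavyLowerTailCILReduction
import Literature.Probability.Percolation.LonelyClusterExchange
import HarnessLib

/-!
# `NoHeavyLowerTail` (stmt-CriticalPhenomena-4575) — the SMALL-BLOCK TRANSFER inequality closes the
# cumulative isolation lemma (all levels) and the crux; its one- and two-target instances

Seat `prim-gen-swap` (gen 1), 2026-08-18.  Bond percolation `μ = prodBernoulli w` on `Fin n`, relay set `A`,
level `j`, `π(v) = {z ∈ A : v ↔ z}` (the Finset `A.filter (fun z => ω ∈ openConn v z)`), loneliness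
`r_v = μ(R_v)`, `R_v = {|π(v)| ≤ j}`.

**Small-block transfer (registered stub `stub_smallBlockTransfer`; report `MAX-TRANSFER.md` on the item).**
For an observer `o ∉ A`, a set of targets `W ⊆ A` and a relay `a ∈ A` at least as lonely as every target
(`r_b ≤ r_a` for all `b ∈ W`):

  `μ(o ↔ W, |π(o)| ≤ j) ≤ μ(o ↔ W, |π(a)| ≤ j)`                                        (T)

("given that `o` reaches `W`, the block of `o` is no more likely to be small than the block of the loneliest
relay").  With `W = A` and `a = c` a champion (`r_c = max_A r`) this is the sharp cumulative isolation lemma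
`μ(1 ≤ N ≤ j) ≤ μ(N ≥ 1, |π(c)| ≤ j) ≤ μ(|π(c)| ≤ j)`, so (T) implies the registered `stub_cumulativeIsolation`
at every level and hence the crux (`cumulativeIsolation_of_smallBlockTransfer`,
`noHeavyLowerTail_of_smallBlockTransfer`, via the landed `noHeavyLowerTail_of_stub_cumulativeIsolation`).
Evidence for (T): 0 failures in ≈ 3·10⁸ exhaustive `p = ½` multigraph instances (k ≤ 7 relays, n ≤ 8) and
≈ 3·10⁴ exact weighted instances; the hypothesis `r_b ≤ r_a ∀ b ∈ W` is necessary (≈ 25 % failures without it).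

PROVED here: the instances `W = {b}` (`smallBlockTransfer_singleton`) and `W = {a, b}`
(`smallBlockTransfer_pair`) of (T), from van den Berg–Häggström–Kahn's two-cluster exchange (tree:
`lonelyClusterExchange_typeMinus`) in the loss-free direction `SmallBlockTransfer.transfer_le`:
for `s ≠ t` with `r_t ≤ r_s` and any event `B` closed under (shrinking `C_s`, enlarging `C_t`),
`μ(s ↮ t, R_t, B) ≤ μ(s ↮ t, R_s, B)`.
-/

noncomputable section

namespace Summit.CriticalPhenomena.PercolationContinuityZ3.Theorems

open MeasureTheory Set Literature.Probability.LatticeModels Literature.Probability.Percolation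
open scoped Classical BigOperators

variable {n : ℕ}

namespace SmallBlockTransfer

/-- **Loss-free lonely-cluster transfer.**  For `s ≠ t` with `μ(R_t) ≤ μ(R_s)` and an event `B` closed under
(shrinking `C_s`, enlarging `C_t`): `μ({s ↮ t} ∩ (R_t ∩ B)) ≤ μ({s ↮ t} ∩ (B ∩ R_s))`.  From the exchange
`m₁ m₂ ≤ m₃ m₄` (`lonelyClusterExchange_typeMinus`) and `m₃ − m₂ = μ(R_t) − μ(R_s) ≤ 0`
(the loneliness events of `s` and `t` agree on `{s ↔ t}`).
[cite: VandenbergHaggstromKahn2005, Thm. 1.5 (p. 7) — corollary] -/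
theorem transfer_le {V : Type*} [Fintype V] (w : Sym2 V → unitInterval) {s t : V} (hst : s ≠ t)
    (A : Finset V) (j : ℕ) {B : Set (BondConfig V)}
    (hB : ∀ ⦃ω ω' : BondConfig V⦄, openEdgeCluster ω' s ⊆ openEdgeCluster ω s →
      openEdgeCluster ω t ⊆ openEdgeCluster ω' t → ω ∈ B → ω' ∈ B)
    (hle : (prodBernoulli w).real {ω : BondConfig V | (A.filter fun z => ω ∈ openConn t z).card ≤ j} ≤
      (prodBernoulli w).real {ω : BondConfig V | (A.filter fun z => ω ∈ openConn s z).card ≤ j}) :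
    (prodBernoulli w).real ((openConn s t)ᶜ ∩
        ({ω : BondConfig V | (A.filter fun z => ω ∈ openConn t z).card ≤ j} ∩ B)) ≤
      (prodBernoulli w).real ((openConn s t)ᶜ ∩
        (B ∩ {ω : BondConfig V | (A.filter fun z => ω ∈ openConn s z).card ≤ j})) := by
  set μ := prodBernoulli w with hμ
  set Rt : Set (BondConfig V) := {ω | (A.filter fun z => ω ∈ openConn t z).card ≤ j} with hRt
  set Rs : Set (BondConfig V) := {ω | (A.filter fun z => ω ∈ openConn s z).card ≤ j} with hRs
  set D : Set (BondConfig V) := (openConn s t)ᶜ with hD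
  have hmeas : ∀ S : Set (BondConfig V), MeasurableSet S := fun S => (Set.toFinite S).measurableSet
  have key : μ.real (D ∩ (Rt ∩ B)) * μ.real (D ∩ Rs) ≤ μ.real (D ∩ Rt) * μ.real (D ∩ (B ∩ Rs)) :=
    lonelyClusterExchange_typeMinus w hst A j hB
  -- on `{s ↔ t}` the two loneliness events coincide
  have hF2 : Rt \ D = Rs \ D := by
    ext ω
    simp only [hRt, hRs, hD, mem_sdiff, mem_compl_iff, not_not, mem_setOf_eq]
    constructor
    · rintro ⟨h, hst'⟩
      have hst'' : (openGraph ω).Reachable s t := hst'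
      have heq : (A.filter fun z => ω ∈ openConn s z) = (A.filter fun z => ω ∈ openConn t z) :=
        Finset.filter_congr fun z _ =>
          ⟨fun hz => (hst''.symm.trans hz : (openGraph ω).Reachable t z),
            fun hz => (hst''.trans hz : (openGraph ω).Reachable s z)⟩
      rw [heq]
      exact ⟨h, hst'⟩
    · rintro ⟨h, hst'⟩
      have hst'' : (openGraph ω).Reachable s t := hst'
      have heq : (A.filter fun z => ω ∈ openConn t z) = (A.filter fun z => ω ∈ openConn s z) :=
        Finset.filter_congr fun z _ =>
          ⟨fun hz => (hst''.trans hz : (openGraph ω).Reachable s z),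
            fun hz => (hst''.symm.trans hz : (openGraph ω).Reachable t z)⟩
      rw [heq]
      exact ⟨h, hst'⟩
  have hsplit_t : μ.real (Rt ∩ D) + μ.real (Rt \ D) = μ.real Rt := measureReal_inter_add_sdiff (hmeas D)
  have hsplit_s : μ.real (Rs ∩ D) + μ.real (Rs \ D) = μ.real Rs := measureReal_inter_add_sdiff (hmeas D)
  have h32 : μ.real (D ∩ Rt) ≤ μ.real (D ∩ Rs) := by
    rw [inter_comm D Rt, inter_comm D Rs]
    have : μ.real Rt ≤ μ.real Rs := hle
    rw [hF2] at hsplit_t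
    linarith
  have hm1 : μ.real (D ∩ (Rt ∩ B)) ≤ μ.real (D ∩ Rt) :=
    measureReal_mono (inter_subset_inter_right _ inter_subset_left)
  by_cases h0 : μ.real (D ∩ Rs) = 0
  · have h3 : μ.real (D ∩ Rt) = 0 := le_antisymm (h0 ▸ h32) measureReal_nonneg
    have h1 : μ.real (D ∩ (Rt ∩ B)) = 0 := le_antisymm (h3 ▸ hm1) measureReal_nonneg
    rw [h1]
    exact measureReal_nonneg
  · have hpos : 0 < μ.real (D ∩ Rs) := lt_of_le_of_ne measureReal_nonneg (Ne.symm h0)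
    have h' : μ.real (D ∩ (Rt ∩ B)) * μ.real (D ∩ Rs) ≤ μ.real (D ∩ Rs) * μ.real (D ∩ (B ∩ Rs)) := by
      calc μ.real (D ∩ (Rt ∩ B)) * μ.real (D ∩ Rs)
          ≤ μ.real (D ∩ Rt) * μ.real (D ∩ (B ∩ Rs)) := key
        _ ≤ μ.real (D ∩ Rs) * μ.real (D ∩ (B ∩ Rs)) :=
            mul_le_mul_of_nonneg_right h32 measureReal_nonneg
    rw [mul_comm] at h'
    exact le_of_mul_le_mul_left h' hpos

/-- When `o ↔ b`, the relay sets seen from `o` and from `b` coincide. [folklore] -/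
theorem filter_eq_of_reachable (A : Finset (Fin n)) {ω : BondConfig (Fin n)} {o b : Fin n}
    (h : (openGraph ω).Reachable o b) :
    (A.filter fun z => ω ∈ openConn o z) = (A.filter fun z => ω ∈ openConn b z) :=
  Finset.filter_congr fun z _ =>
    ⟨fun hz => (h.symm.trans hz : (openGraph ω).Reachable b z),
      fun hz => (h.trans hz : (openGraph ω).Reachable o z)⟩

/-- **The transfer step.**  For relays/vertices `a ≠ b` with `r_b ≤ r_a` and any vertex `o`:
`μ(o ↔ b, o ↮ a, |π(o)| ≤ j) ≤ μ(o ↔ b, o ↮ a, |π(a)| ≤ j)`.  (On the event, `a ↮ b` and `π(o) = π(b)`;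
apply `transfer_le` with `s = a`, `t = b`, `B = {b ↔ o}`.) -/
theorem transfer_step (w : Sym2 (Fin n) → unitInterval) (A : Finset (Fin n)) {a b : Fin n}
    (hab : a ≠ b) (o : Fin n) (j : ℕ)
    (hle : (prodBernoulli w).real
        {ω : BondConfig (Fin n) | (A.filter fun z => ω ∈ openConn b z).card ≤ j} ≤
      (prodBernoulli w).real
        {ω : BondConfig (Fin n) | (A.filter fun z => ω ∈ openConn a z).card ≤ j}) :
    (prodBernoulli w).real {ω : BondConfig (Fin n) | ω ∈ openConn o b ∧ ω ∉ openConn o a ∧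
        (A.filter fun z => ω ∈ openConn o z).card ≤ j} ≤
      (prodBernoulli w).real {ω : BondConfig (Fin n) | ω ∈ openConn o b ∧ ω ∉ openConn o a ∧
        (A.filter fun z => ω ∈ openConn a z).card ≤ j} := by
  have key := transfer_le w hab A j (B := (openConn b o : Set (BondConfig (Fin n))))
    (typeMinus_openConn a b o) hle
  have e1 : {ω : BondConfig (Fin n) | ω ∈ openConn o b ∧ ω ∉ openConn o a ∧
      (A.filter fun z => ω ∈ openConn o z).card ≤ j} =
      (openConn a b)ᶜ ∩ ({ω : BondConfig (Fin n) | (A.filter fun z => ω ∈ openConn b z).card ≤ j} ∩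
        openConn b o) := by
    ext ω
    simp only [mem_setOf_eq, mem_inter_iff, mem_compl_iff]
    constructor
    · rintro ⟨hob, hoa, hcard⟩
      have hob' : (openGraph ω).Reachable o b := hob
      refine ⟨fun hab' => hoa ?_, ?_, (hob'.symm : (openGraph ω).Reachable b o)⟩
      · have hab'' : (openGraph ω).Reachable a b := hab'
        exact (hob'.trans hab''.symm : (openGraph ω).Reachable o a)
      · rwa [← filter_eq_of_reachable A hob']
    · rintro ⟨hab', hcard, hbo⟩
      have hbo' : (openGraph ω).Reachable b o := hbo
      refine ⟨(hbo'.symm : (openGraph ω).Reachable o b), fun hoa => hab' ?_, ?_⟩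
      · have hoa' : (openGraph ω).Reachable o a := hoa
        exact ((hbo'.trans hoa').symm : (openGraph ω).Reachable a b)
      · rwa [filter_eq_of_reachable A hbo'.symm]
  have e2 : {ω : BondConfig (Fin n) | ω ∈ openConn o b ∧ ω ∉ openConn o a ∧
      (A.filter fun z => ω ∈ openConn a z).card ≤ j} =
      (openConn a b)ᶜ ∩ ((openConn b o : Set (BondConfig (Fin n))) ∩
        {ω : BondConfig (Fin n) | (A.filter fun z => ω ∈ openConn a z).card ≤ j}) := by
    ext ω
    simp only [mem_setOf_eq, mem_inter_iff, mem_compl_iff]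
    constructor
    · rintro ⟨hob, hoa, hcard⟩
      have hob' : (openGraph ω).Reachable o b := hob
      refine ⟨fun hab' => hoa ?_, (hob'.symm : (openGraph ω).Reachable b o), hcard⟩
      have hab'' : (openGraph ω).Reachable a b := hab'
      exact (hob'.trans hab''.symm : (openGraph ω).Reachable o a)
    · rintro ⟨hab', hbo, hcard⟩
      have hbo' : (openGraph ω).Reachable b o := hbo
      refine ⟨(hbo'.symm : (openGraph ω).Reachable o b), fun hoa => hab' ?_, hcard⟩
      have hoa' : (openGraph ω).Reachable o a := hoa
      exact ((hbo'.trans hoa').symm : (openGraph ω).Reachable a b)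
  rw [e1, e2]
  exact key

end SmallBlockTransfer

open SmallBlockTransfer

/-- **Small-block transfer, one target** (`W = {b}`).  If `r_b ≤ r_a` then
`μ(o ↔ b, |π(o)| ≤ j) ≤ μ(o ↔ b, |π(a)| ≤ j)`: split along `{o ↔ a}` (there `π(o) = π(a)`) and use
`transfer_step` off it. -/
theorem smallBlockTransfer_singleton (w : Sym2 (Fin n) → unitInterval) (A : Finset (Fin n))
    (o a b : Fin n) (j : ℕ)
    (hle : (prodBernoulli w).real
        {ω : BondConfig (Fin n) | (A.filter fun z => ω ∈ openConn b z).card ≤ j} ≤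
      (prodBernoulli w).real
        {ω : BondConfig (Fin n) | (A.filter fun z => ω ∈ openConn a z).card ≤ j}) :
    (prodBernoulli w).real {ω : BondConfig (Fin n) | ω ∈ openConn o b ∧
        (A.filter fun z => ω ∈ openConn o z).card ≤ j} ≤
      (prodBernoulli w).real {ω : BondConfig (Fin n) | ω ∈ openConn o b ∧
        (A.filter fun z => ω ∈ openConn a z).card ≤ j} := by
  set μ := prodBernoulli w with hμ
  have hmeas : ∀ S : Set (BondConfig (Fin n)), MeasurableSet S :=
    fun S => (Set.toFinite S).measurableSet
  by_cases hab : a = b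
  · subst hab
    refine le_of_eq (congrArg μ.real ?_)
    ext ω
    simp only [mem_setOf_eq]
    constructor
    · rintro ⟨hob, hcard⟩
      exact ⟨hob, by rwa [← filter_eq_of_reachable A (hob : (openGraph ω).Reachable o a)]⟩
    · rintro ⟨hob, hcard⟩
      exact ⟨hob, by rwa [filter_eq_of_reachable A (hob : (openGraph ω).Reachable o a)]⟩
  set C : Set (BondConfig (Fin n)) := openConn o a with hC
  set L : Set (BondConfig (Fin n)) := {ω | ω ∈ openConn o b ∧
      (A.filter fun z => ω ∈ openConn o z).card ≤ j} with hL
  set R : Set (BondConfig (Fin n)) := {ω | ω ∈ openConn o b ∧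
      (A.filter fun z => ω ∈ openConn a z).card ≤ j} with hR
  have hsplit : ∀ S : Set (BondConfig (Fin n)), μ.real S = μ.real (S ∩ C) + μ.real (S \ C) :=
    fun S => (measureReal_inter_add_sdiff (μ := μ) (s := S) (hmeas C)).symm
  have hLC : L ∩ C = R ∩ C := by
    ext ω
    simp only [hL, hR, hC, mem_inter_iff, mem_setOf_eq]
    constructor
    · rintro ⟨⟨hob, hcard⟩, hoa⟩
      exact ⟨⟨hob, by rwa [← filter_eq_of_reachable A (hoa : (openGraph ω).Reachable o a)]⟩, hoa⟩
    · rintro ⟨⟨hob, hcard⟩, hoa⟩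
      exact ⟨⟨hob, by rwa [filter_eq_of_reachable A (hoa : (openGraph ω).Reachable o a)]⟩, hoa⟩
  have hLoff : L \ C = {ω : BondConfig (Fin n) | ω ∈ openConn o b ∧ ω ∉ openConn o a ∧
      (A.filter fun z => ω ∈ openConn o z).card ≤ j} := by
    ext ω; simp only [hL, hC, mem_sdiff, mem_setOf_eq]; tauto
  have hRoff : R \ C = {ω : BondConfig (Fin n) | ω ∈ openConn o b ∧ ω ∉ openConn o a ∧
      (A.filter fun z => ω ∈ openConn a z).card ≤ j} := by
    ext ω; simp only [hR, hC, mem_sdiff, mem_setOf_eq]; tauto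
  have key := transfer_step w A hab o j hle
  rw [hsplit L, hsplit R, hLC, hLoff, hRoff]
  linarith

/-- **Small-block transfer, two targets one of which is the lonely relay** (`W = {a, b}`, `r_b ≤ r_a`):
`μ(o ↔ {a,b}, |π(o)| ≤ j) ≤ μ(o ↔ {a,b}, |π(a)| ≤ j)`.  Split `{o ↔ a or o ↔ b}` into `{o ↔ a}` (where
`π(o) = π(a)`) and `{o ↔ b, o ↮ a}` (`transfer_step`). -/
theorem smallBlockTransfer_pair (w : Sym2 (Fin n) → unitInterval) (A : Finset (Fin n))
    (o a b : Fin n) (j : ℕ)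
    (hle : (prodBernoulli w).real
        {ω : BondConfig (Fin n) | (A.filter fun z => ω ∈ openConn b z).card ≤ j} ≤
      (prodBernoulli w).real
        {ω : BondConfig (Fin n) | (A.filter fun z => ω ∈ openConn a z).card ≤ j}) :
    (prodBernoulli w).real {ω : BondConfig (Fin n) | (ω ∈ openConn o a ∨ ω ∈ openConn o b) ∧
        (A.filter fun z => ω ∈ openConn o z).card ≤ j} ≤
      (prodBernoulli w).real {ω : BondConfig (Fin n) | (ω ∈ openConn o a ∨ ω ∈ openConn o b) ∧
        (A.filter fun z => ω ∈ openConn a z).card ≤ j} := by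
  set μ := prodBernoulli w with hμ
  have hmeas : ∀ S : Set (BondConfig (Fin n)), MeasurableSet S :=
    fun S => (Set.toFinite S).measurableSet
  by_cases hab : a = b
  · subst hab
    refine le_of_eq (congrArg μ.real ?_)
    ext ω
    simp only [mem_setOf_eq, or_self]
    constructor
    · rintro ⟨hoa, hcard⟩
      exact ⟨hoa, by rwa [← filter_eq_of_reachable A (hoa : (openGraph ω).Reachable o a)]⟩
    · rintro ⟨hoa, hcard⟩
      exact ⟨hoa, by rwa [filter_eq_of_reachable A (hoa : (openGraph ω).Reachable o a)]⟩
  set C : Set (BondConfig (Fin n)) := openConn o a with hC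
  set L : Set (BondConfig (Fin n)) := {ω | (ω ∈ openConn o a ∨ ω ∈ openConn o b) ∧
      (A.filter fun z => ω ∈ openConn o z).card ≤ j} with hL
  set R : Set (BondConfig (Fin n)) := {ω | (ω ∈ openConn o a ∨ ω ∈ openConn o b) ∧
      (A.filter fun z => ω ∈ openConn a z).card ≤ j} with hR
  have hsplit : ∀ S : Set (BondConfig (Fin n)), μ.real S = μ.real (S ∩ C) + μ.real (S \ C) :=
    fun S => (measureReal_inter_add_sdiff (μ := μ) (s := S) (hmeas C)).symm
  have hLC : L ∩ C = R ∩ C := by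
    ext ω
    simp only [hL, hR, hC, mem_inter_iff, mem_setOf_eq]
    constructor
    · rintro ⟨⟨hob, hcard⟩, hoa⟩
      exact ⟨⟨hob, by rwa [← filter_eq_of_reachable A (hoa : (openGraph ω).Reachable o a)]⟩, hoa⟩
    · rintro ⟨⟨hob, hcard⟩, hoa⟩
      exact ⟨⟨hob, by rwa [filter_eq_of_reachable A (hoa : (openGraph ω).Reachable o a)]⟩, hoa⟩
  have hLoff : L \ C = {ω : BondConfig (Fin n) | ω ∈ openConn o b ∧ ω ∉ openConn o a ∧
      (A.filter fun z => ω ∈ openConn o z).card ≤ j} := by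
    ext ω; simp only [hL, hC, mem_sdiff, mem_setOf_eq]; tauto
  have hRoff : R \ C = {ω : BondConfig (Fin n) | ω ∈ openConn o b ∧ ω ∉ openConn o a ∧
      (A.filter fun z => ω ∈ openConn a z).card ≤ j} := by
    ext ω; simp only [hR, hC, mem_sdiff, mem_setOf_eq]; tauto
  have key := transfer_step w A hab o j hle
  rw [hsplit L, hsplit R, hLC, hLoff, hRoff]
  linarith

/-- **Small-block transfer ⇒ the cumulative isolation lemma (registered `stub_cumulativeIsolation`), all levels.**
Given (T), for `A` nonempty and `o ∉ A` pick a champion `c ∈ argmax_A r`; then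
`{1 ≤ N ≤ j} = {o ↔ A, |π(o)| ≤ j}` and (T) with `W = A`, `a = c` gives
`μ(1 ≤ N ≤ j) ≤ μ(o ↔ A, |π(c)| ≤ j) ≤ μ(|π(c)| ≤ j)`. -/
theorem cumulativeIsolation_of_smallBlockTransfer
    (hT : ∀ (n : ℕ) (w : Sym2 (Fin n) → unitInterval) (A W : Finset (Fin n)) (o a : Fin n) (j : ℕ),
      W ⊆ A → o ∉ A → a ∈ A →
      (∀ b ∈ W,
        (Literature.Probability.LatticeModels.prodBernoulli w).real
            {ω : Literature.Probability.Percolation.BondConfig (Fin n) |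
              (A.filter fun z => ω ∈ Literature.Probability.Percolation.openConn b z).card ≤ j} ≤
          (Literature.Probability.LatticeModels.prodBernoulli w).real
            {ω : Literature.Probability.Percolation.BondConfig (Fin n) |
              (A.filter fun z => ω ∈ Literature.Probability.Percolation.openConn a z).card ≤ j}) →
      (Literature.Probability.LatticeModels.prodBernoulli w).real
          {ω : Literature.Probability.Percolation.BondConfig (Fin n) |
            (∃ b ∈ W, ω ∈ Literature.Probability.Percolation.openConn o b) ∧
            (A.filter fun z => ω ∈ Literature.Probability.Percolation.openConn o z).card ≤ j} ≤
        (Literature.Probability.LatticeModels.prodBernoulli w).real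
          {ω : Literature.Probability.Percolation.BondConfig (Fin n) |
            (∃ b ∈ W, ω ∈ Literature.Probability.Percolation.openConn o b) ∧
            (A.filter fun z => ω ∈ Literature.Probability.Percolation.openConn a z).card ≤ j}) :
    ∀ (n : ℕ) (w : Sym2 (Fin n) → unitInterval) (A : Finset (Fin n)) (o : Fin n) (j : ℕ),
      A.Nonempty → o ∉ A → ∃ a ∈ A,
        (Literature.Probability.LatticeModels.prodBernoulli w).real
            {ω : Literature.Probability.Percolation.BondConfig (Fin n) |
              1 ≤ (A.filter fun x => ω ∈ Literature.Probability.Percolation.openConn o x).card ∧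
                (A.filter fun x => ω ∈ Literature.Probability.Percolation.openConn o x).card ≤ j} ≤
          (Literature.Probability.LatticeModels.prodBernoulli w).real
            {ω : Literature.Probability.Percolation.BondConfig (Fin n) |
              (A.filter fun x => ω ∈ Literature.Probability.Percolation.openConn a x).card ≤ j} := by
  intro n w A o j hA ho
  set μ := prodBernoulli w with hμ
  obtain ⟨c, hc, hmax⟩ := Finset.exists_max_image A
    (fun a => μ.real {ω : BondConfig (Fin n) | (A.filter fun z => ω ∈ openConn a z).card ≤ j}) hA
  refine ⟨c, hc, ?_⟩
  have key := hT n w A A o c j (subset_refl A) ho hc hmax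
  have e1 : {ω : BondConfig (Fin n) |
      1 ≤ (A.filter fun x => ω ∈ openConn o x).card ∧ (A.filter fun x => ω ∈ openConn o x).card ≤ j} =
      {ω : BondConfig (Fin n) | (∃ b ∈ A, ω ∈ openConn o b) ∧
        (A.filter fun z => ω ∈ openConn o z).card ≤ j} := by
    ext ω
    simp only [mem_setOf_eq, Nat.one_le_iff_ne_zero, Ne, Finset.card_eq_zero,
      Finset.filter_eq_empty_iff, not_forall, not_not, exists_prop]
  rw [e1]
  refine key.trans (measureReal_mono ?_)
  intro ω hω
  exact hω.2

/-- **Small-block transfer closes the crux**: `stub_smallBlockTransfer → NoHeavyLowerTail`, through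
`cumulativeIsolation_of_smallBlockTransfer` and the landed `noHeavyLowerTail_of_stub_cumulativeIsolation`. -/
theorem noHeavyLowerTail_of_smallBlockTransfer
    (hT : ∀ (n : ℕ) (w : Sym2 (Fin n) → unitInterval) (A W : Finset (Fin n)) (o a : Fin n) (j : ℕ),
      W ⊆ A → o ∉ A → a ∈ A →
      (∀ b ∈ W,
        (Literature.Probability.LatticeModels.prodBernoulli w).real
            {ω : Literature.Probability.Percolation.BondConfig (Fin n) |
              (A.filter fun z => ω ∈ Literature.Probability.Percolation.openConn b z).card ≤ j} ≤
          (Literature.Probability.LatticeModels.prodBernoulli w).real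
            {ω : Literature.Probability.Percolation.BondConfig (Fin n) |
              (A.filter fun z => ω ∈ Literature.Probability.Percolation.openConn a z).card ≤ j}) →
      (Literature.Probability.LatticeModels.prodBernoulli w).real
          {ω : Literature.Probability.Percolation.BondConfig (Fin n) |
            (∃ b ∈ W, ω ∈ Literature.Probability.Percolation.openConn o b) ∧
            (A.filter fun z => ω ∈ Literature.Probability.Percolation.openConn o z).card ≤ j} ≤
        (Literature.Probability.LatticeModels.prodBernoulli w).real
          {ω : Literature.Probability.Percolation.BondConfig (Fin n) |
            (∃ b ∈ W, ω ∈ Literature.Probability.Percolation.openConn o b) ∧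
            (A.filter fun z => ω ∈ Literature.Probability.Percolation.openConn a z).card ≤ j}) :
    Summit.CriticalPhenomena.PercolationContinuityZ3.Theses.PercNearOneGluing.NoHeavyLowerTail :=
  noHeavyLowerTail_of_stub_cumulativeIsolation (cumulativeIsolation_of_smallBlockTransfer hT)

end Summit.CriticalPhenomena.PercolationContinuityZ3.Theorems

end
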